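import Literature.AlgebraicTopology.SingularHomology.RelativeCapProduct
import Literature.AlgebraicTopology.SingularHomology.NoncompactManifoldProofs
import HarnessLib

/-!
# The cap product of a cochain defined near `K` with the local homology `H(X | K)`

H. Miller, *Lectures on Algebraic Topology* (2020), §34 (pp. 111–112): for `K ⊆ X` closed and
`U ⊇ K` open, excision `H_*(U, U - K) ≅ H_*(X, X - K)` makes the cap product with `H^*(X)` on
`H_*(X, X - K)` factor through `H^*(U)` ("the `H^*(X)` action factors through an action by
`H^*(U)`, for any open set `U` containing `K`", Lemma 34.3: compatibility when `U` decreases, "just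
the projection formula again"), which is the origin of the pairing
`Ȟ^p(K) ⊗ Hₙ(X, X - K) → H_q(X, X - K)` of Def. 34.4; and A. Hatcher, *Algebraic Topology* (2002),
§3.3, p. 239 (the Alexander–Whitney chain-level cap product, its boundary formula) and Prop. 2.21
(small chains).

This file constructs that pairing **at chain level in the concrete model** of the tree
(`clocalHomology R M X K q = H_q(C(X)/C(X ∖ K))`, `LocalHomology.lean`; the Alexander–Whitney cap
`ccapChain` and its boundary formula, `RelativeCapProduct.lean`), in the generality needed for the
Čech-cohomology cap product and its Mayer–Vietoris ladder (Miller Thm. 36.2): the cochain is a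
*function cochain* `φ : (singular p-simplices of X) → R` which is only required to be a cocycle on
the simplices that are small with respect to an open cover `U` of `K` (`IsCocycleOn U φ`), and it
is capped with *`U`-small* representatives of classes of `Hₙ(X | K)`, which exist and are unique up
to small boundaries by Prop. 2.21 / excision (`clocalHomology.exists_small_relCls_eq`,
`clocalHomology.exists_small_of_relCls_eq_zero`).

Main definitions and results (all proved, no named facts):

* `mem_smallChains_iff`, `smallPart` — bookkeeping of `U`-small chains;
* `clocalHomology.exists_small_relCls_eq` / `exists_small_of_relCls_eq_zero` — every class of
  `Hₖ(X | K)` has a `U`-small representative; a `U`-small relative cycle representing `0` is a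
  `U`-small boundary modulo `C(X ∖ K)` (Hatcher Prop. 2.21 + Thm. 2.20, element form);
* `IsCocycleOn U φ`, `d_ccapChain_of_isCocycleOn` — `∂(x ⌢ φ) = (-1)ᵖ ∂x ⌢ φ` for `x` small;
* `clocalHomology.capSmall` — the class `[x ⌢ φ] ∈ H_q(X | K)` of a small relative cycle `x`, and
  its independence of the representative (`capSmall_eq_of_relCls_eq`);
* `clocalHomology.capLoc` — **the cap product `φ ⌢ - : Hₙ(X | K) → H_q(X | K)`** with a cochain
  that is a cocycle near `K` (Miller §34), with: linearity in `φ`, dependence on `φ` only through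
  its values on small simplices modulo coboundaries (`capLoc_congr`, `capLoc_eq_zero_of_coboundary`),
  independence of the cover (`capLoc_refine`), naturality under restriction to `L ⊆ K`
  (`res_capLoc`, Miller Lemma 34.3 / projection formula) and `1 ⌢ α = α` (`capLoc_one`).

## References

* H. Miller, *Lectures on Algebraic Topology*, World Scientific 2020, §34 (relative cap product,
  Lemma 34.3, Def. 34.4). [Miller2020]
* A. Hatcher, *Algebraic Topology*, CUP 2002, §2.1 Prop. 2.21, Thm. 2.20; §3.3 p. 239–241.
  [HatcherAT2002]
-/

noncomputable section

-- as in `SingularChainsConcrete` / `LocalHomology`: chains of the concrete complex are `Finsupp`s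
-- up to unfolding of semireducible definitions
set_option backward.isDefEq.respectTransparency false

open CategoryTheory Limits

universe u v

namespace Literature.AlgebraicTopology.SingularHomology

variable (R : Type v) [CommRing R] (M : Type v) [AddCommGroup M] [Module R M]
variable {X : Type u} [TopologicalSpace X]

/-! ### Small chains: membership, the small part of a chain, the cover `U ∪ {X ∖ K}` -/

section Small

variable {ι : Type*}

/-- A chain is `U`-small iff every simplex in its support lies in some `Uᵢ` (Hatcher 2002,
Prop. 2.21, "chains `∑ nᵢσᵢ` such that each `σᵢ` has image contained in some set in the cover").
[cite: HatcherAT2002, Prop. 2.21] -/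
lemma mem_smallChains_iff (U : ι → Set X) {n : ℕ} (c : CChain M X n) :
    c ∈ smallChains R M X U n ↔ ∀ σ ∈ c.support, ∃ i, σ.range ⊆ U i := by
  have h : smallChains R M X U n = Finsupp.supported M R (⋃ i, simplicesIn X (U i) n) := by
    rw [smallChains, Finsupp.supported_iUnion]
    rfl
  rw [h, Finsupp.mem_supported']
  constructor
  · intro hc σ hσ
    by_contra hne
    exact (Finsupp.mem_support_iff.mp hσ) (hc σ fun hmem => hne (Set.mem_iUnion.mp hmem))
  · intro hc σ hσ
    by_contra hcσ
    exact hσ (Set.mem_iUnion.mpr (hc σ (Finsupp.mem_support_iff.mpr hcσ)))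

/-- An elementary chain on a simplex in some `Uᵢ` is small. [folklore] -/
lemma single_mem_smallChains (U : ι → Set X) {n : ℕ} {σ : SingularSimplex X n} {i : ι}
    (hσ : σ.range ⊆ U i) (m : M) : Finsupp.single σ m ∈ smallChains R M X U n :=
  Submodule.mem_iSup_of_mem i (single_mem_chainsIn R M hσ m)

/-- Small chains for a refinement are small: if every `Vⱼ` lies in some `Uᵢ` then
`C^𝒱 ≤ C^𝒰`. [folklore] -/
lemma smallChains_mono_of_refines {ι' : Type*} {U : ι → Set X} {V : ι' → Set X}
    (hVU : ∀ j, ∃ i, V j ⊆ U i) (n : ℕ) : smallChains R M X V n ≤ smallChains R M X U n := by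
  intro c hc
  rw [mem_smallChains_iff] at hc ⊢
  intro σ hσ
  obtain ⟨j, hj⟩ := hc σ hσ
  obtain ⟨i, hi⟩ := hVU j
  exact ⟨i, hj.trans hi⟩

/-- A chain with image in some `Uᵢ` is small. [folklore] -/
lemma chainsIn_le_smallChains (U : ι → Set X) (i : ι) (n : ℕ) :
    chainsIn R M X (U i) n ≤ smallChains R M X U n :=
  le_iSup (fun i => chainsIn R M X (U i) n) i

open Classical in
/-- **The `U`-small part of a chain**: the sub-sum over the simplices lying in some `Uᵢ`.
[folklore] -/
def smallPart (U : ι → Set X) {n : ℕ} (c : CChain M X n) : CChain M X n :=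
  c.filter fun σ => ∃ i, σ.range ⊆ U i

/-- The small part of a chain is small. [folklore] -/
lemma smallPart_mem_smallChains (U : ι → Set X) {n : ℕ} (c : CChain M X n) :
    smallPart M U c ∈ smallChains R M X U n := by
  classical
  rw [mem_smallChains_iff]
  intro σ hσ
  rw [smallPart, Finsupp.support_filter, Finset.mem_filter] at hσ
  exact hσ.2

/-- The small part of a small chain is the chain. [folklore] -/
lemma smallPart_eq_self_of_mem (U : ι → Set X) {n : ℕ} {c : CChain M X n}
    (hc : c ∈ smallChains R M X U n) : smallPart M U c = c := by
  classical
  rw [smallPart, Finsupp.filter_eq_self_iff]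
  intro σ hσ
  exact (mem_smallChains_iff R M U c).mp hc σ (Finsupp.mem_support_iff.mpr hσ)

/-- **The open cover `U ∪ {X ∖ K}` of `X`** attached to a cover `U` of `K`, indexed by `Option ι`
(`none ↦ X ∖ K`). (Hatcher 2002, proof of Thm. 2.20: excision is Prop. 2.21 for the cover
`{A, B}` with `X = int A ∪ int B`.) [cite: HatcherAT2002, Thm. 2.20] -/
def coverWithCompl (K : Set X) (U : ι → Set X) : Option ι → Set X := fun o => o.elim Kᶜ U

omit [TopologicalSpace X] in
/-- The extra set of the cover `U ∪ {X ∖ K}` is `X ∖ K`. [folklore] -/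
@[simp] lemma coverWithCompl_none (K : Set X) (U : ι → Set X) : coverWithCompl K U none = Kᶜ := rfl

omit [TopologicalSpace X] in
/-- The sets of `U` are sets of the cover `U ∪ {X ∖ K}`. [folklore] -/
@[simp] lemma coverWithCompl_some (K : Set X) (U : ι → Set X) (i : ι) :
    coverWithCompl K U (some i) = U i := rfl

/-- The sets of `U ∪ {X ∖ K}` are open when `K` is closed and the `Uᵢ` are open. [folklore] -/
lemma isOpen_coverWithCompl {K : Set X} (hK : IsClosed K) {U : ι → Set X}
    (hUo : ∀ i, IsOpen (U i)) (o : Option ι) : IsOpen (coverWithCompl K U o) := by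
  cases o with
  | none => exact hK.isOpen_compl
  | some i => exact hUo i

omit [TopologicalSpace X] in
/-- `U ∪ {X ∖ K}` covers `X` when `U` covers `K`. [folklore] -/
lemma univ_subset_iUnion_coverWithCompl {K : Set X} {U : ι → Set X} (hKU : K ⊆ ⋃ i, U i) :
    (Set.univ : Set X) ⊆ ⋃ o, coverWithCompl K U o := by
  intro x _
  by_cases hx : x ∈ K
  · obtain ⟨i, hi⟩ := Set.mem_iUnion.mp (hKU hx)
    exact Set.mem_iUnion.mpr ⟨some i, hi⟩
  · exact Set.mem_iUnion.mpr ⟨none, hx⟩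

/-- `C(X ∖ K)` consists of `(U ∪ {X ∖ K})`-small chains. [folklore] -/
lemma awaySub_le_smallSub_coverWithCompl (K : Set X) (U : ι → Set X) :
    awaySub R M X K ≤ smallSub R M X (coverWithCompl K U) :=
  fun n => le_iSup (fun o => chainsIn R M X (coverWithCompl K U o) n) none

/-- `U`-small chains are `(U ∪ {X ∖ K})`-small. [folklore] -/
lemma smallChains_le_smallChains_coverWithCompl (K : Set X) (U : ι → Set X) (n : ℕ) :
    smallChains R M X U n ≤ smallChains R M X (coverWithCompl K U) n :=
  iSup_le fun i => le_iSup (fun o => chainsIn R M X (coverWithCompl K U o) n) (some i)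

/-- A `(U ∪ {X ∖ K})`-small chain is its `U`-small part plus a chain in `X ∖ K`. [folklore] -/
lemma sub_smallPart_mem_awaySub {K : Set X} {U : ι → Set X} {n : ℕ} {c : CChain M X n}
    (hc : c ∈ smallChains R M X (coverWithCompl K U) n) :
    c - smallPart M U c ∈ chainsIn R M X Kᶜ n := by
  classical
  have e : c - smallPart M U c = c.filter fun σ => ¬ ∃ i, σ.range ⊆ U i := by
    rw [smallPart, sub_eq_iff_eq_add, add_comm, Finsupp.filter_add_filter_not]
  rw [e, mem_chainsIn_iff]
  intro σ hσ
  rw [Finsupp.support_filter, Finset.mem_filter] at hσ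
  obtain ⟨o, ho⟩ := (mem_smallChains_iff R M _ c).mp hc σ hσ.1
  cases o with
  | none => exact ho
  | some i => exact absurd ⟨i, ho⟩ hσ.2

end Small

/-! ### Small representatives of local homology classes (Prop. 2.21 + excision, element form) -/

namespace clocalHomology

variable {ι : Type*}

/-- **Every class of `Hₖ(X | K)` has a `U`-small representative**, for `K` closed and `U` an
open cover of `K`: Prop. 2.21 for the cover `U ∪ {X ∖ K}` of `X` makes
`(C^𝒰 + C(X ∖ K))/C(X ∖ K) → C(X)/C(X ∖ K)` a quasi-isomorphism (Hatcher 2002, proof of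
Thm. 2.20), and the `C(X ∖ K)`-part of a small representative may be dropped.
[cite: HatcherAT2002, Thm. 2.20] -/
theorem exists_small_relCls_eq {K : Set X} (hK : IsClosed K) {U : ι → Set X}
    (hUo : ∀ i, IsOpen (U i)) (hKU : K ⊆ ⋃ i, U i) {k : ℕ} (α : clocalHomology R M X K k) :
    ∃ (x : (csingularChainComplex R M X).X k) (_ : x ∈ smallChains R M X U k)
      (hx : (csingularChainComplex R M X).d k ((ComplexShape.down ℕ).next k) x ∈
        awaySub R M X K ((ComplexShape.down ℕ).next k)),
      (awaySub R M X K).relCls x hx = α := by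
  set W := coverWithCompl K U with hW
  have hWo : ∀ o, IsOpen (W o) := isOpen_coverWithCompl hK hUo
  have hWcov : (Set.univ : Set X) ⊆ ⋃ o, W o := univ_subset_iUnion_coverWithCompl hKU
  set S := smallSub R M X W with hS
  have hTS : awaySub R M X K ≤ S := awaySub_le_smallSub_coverWithCompl R M K U
  have hiso : ∀ j, IsIso (HomologicalComplex.homologyMap S.ι j) :=
    fun j => isIso_homologyMap_ι_smallSub R M W hWo hWcov j
  have hq : IsIso (HomologicalComplex.homologyMap
      (Subcomplex.quotMap S.ι ((awaySub R M X K).comap S.ι) (awaySub R M X K) le_rfl) k) :=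
    Subcomplex.isIso_homologyMap_quotMap_ι hTS k (hiso k) (fun j _ => inferInstance)
  obtain ⟨β, hβ⟩ := ((ConcreteCategory.isIso_iff_bijective _).mp hq).2 α
  obtain ⟨x', hx', rfl⟩ := ((awaySub R M X K).comap S.ι).relCls_surjective β
  rw [Subcomplex.homologyMap_quotMap_relCls] at hβ
  set y : CChain M X k := S.ι.f k x' with hy
  have hdx' : (csingularChainComplex R M X).d k ((ComplexShape.down ℕ).next k) y ∈
      awaySub R M X K ((ComplexShape.down ℕ).next k) :=
    Subcomplex.d_f_mem S.ι _ _ le_rfl x' hx'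
  have hsmall : y ∈ smallChains R M X W k := x'.2
  have hdiff : y - smallPart M U y ∈ awaySub R M X K k := sub_smallPart_mem_awaySub R M hsmall
  have hd : (csingularChainComplex R M X).d k ((ComplexShape.down ℕ).next k)
      (smallPart M U y) ∈ awaySub R M X K ((ComplexShape.down ℕ).next k) := by
    rw [(sub_sub_cancel y (smallPart M U y)).symm, map_sub]
    exact Submodule.sub_mem _ hdx' ((awaySub R M X K).d_mem hdiff)
  refine ⟨smallPart M U y, smallPart_mem_smallChains R M U _, hd, ?_⟩
  rw [← hβ]
  refine ((awaySub R M X K).relCls_eq_relCls_iff _ _ hd hdx').mpr ⟨0, ?_⟩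
  rw [map_zero, zero_sub, neg_sub]
  exact hdiff

/-- **A `U`-small relative cycle representing `0 ∈ Hₖ(X | K)` is a `U`-small boundary modulo
`C(X ∖ K)`**: injectivity of `H((C^𝒰 + C(X ∖ K))/C(X ∖ K)) → H(C(X)/C(X ∖ K))` (Hatcher 2002,
Prop. 2.21 / Thm. 2.20), and again the `C(X ∖ K)`-part of the bounding chain may be dropped.
[cite: HatcherAT2002, Thm. 2.20] -/
theorem exists_small_of_relCls_eq_zero {K : Set X} (hK : IsClosed K) {U : ι → Set X}
    (hUo : ∀ i, IsOpen (U i)) (hKU : K ⊆ ⋃ i, U i) {k : ℕ} {x : (csingularChainComplex R M X).X k}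
    (hxU : x ∈ smallChains R M X U k)
    (hx : (csingularChainComplex R M X).d k ((ComplexShape.down ℕ).next k) x ∈
      awaySub R M X K ((ComplexShape.down ℕ).next k))
    (h0 : (awaySub R M X K).relCls x hx = 0) :
    ∃ w : (csingularChainComplex R M X).X (k + 1), w ∈ smallChains R M X U (k + 1) ∧
      (csingularChainComplex R M X).d (k + 1) k w - x ∈ awaySub R M X K k := by
  set W := coverWithCompl K U with hW
  have hWo : ∀ o, IsOpen (W o) := isOpen_coverWithCompl hK hUo
  have hWcov : (Set.univ : Set X) ⊆ ⋃ o, W o := univ_subset_iUnion_coverWithCompl hKU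
  set S := smallSub R M X W with hS
  have hTS : awaySub R M X K ≤ S := awaySub_le_smallSub_coverWithCompl R M K U
  have hiso : ∀ j, IsIso (HomologicalComplex.homologyMap S.ι j) :=
    fun j => isIso_homologyMap_ι_smallSub R M W hWo hWcov j
  have hq : IsIso (HomologicalComplex.homologyMap
      (Subcomplex.quotMap S.ι ((awaySub R M X K).comap S.ι) (awaySub R M X K) le_rfl) k) :=
    Subcomplex.isIso_homologyMap_quotMap_ι hTS k (hiso k) (fun j _ => inferInstance)
  -- `x` as a chain of `S`
  have hxS : x ∈ S k := smallChains_le_smallChains_coverWithCompl R M K U k hxU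
  set xS : S.toComplex.X k := ⟨x, hxS⟩ with hxSdef
  have hxS' : S.toComplex.d k ((ComplexShape.down ℕ).next k) xS ∈
      ((awaySub R M X K).comap S.ι) ((ComplexShape.down ℕ).next k) := by
    rw [Subcomplex.mem_comap]
    exact hx
  have himg : HomologicalComplex.homologyMap
      (Subcomplex.quotMap S.ι ((awaySub R M X K).comap S.ι) (awaySub R M X K) le_rfl) k
        (((awaySub R M X K).comap S.ι).relCls xS hxS') = 0 := by
    rw [Subcomplex.homologyMap_quotMap_relCls]
    exact h0
  have hzero : ((awaySub R M X K).comap S.ι).relCls xS hxS' = 0 :=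
    ((ConcreteCategory.isIso_iff_bijective _).mp hq).1 (himg.trans (map_zero _).symm)
  obtain ⟨w, hw⟩ := (exists_d_prev_sub_mem_iff (ChainComplex.prev ℕ k) xS _).mp
    ((((awaySub R M X K).comap S.ι).relCls_eq_zero_iff xS hxS').mp hzero)
  rw [Subcomplex.mem_comap, map_sub] at hw
  -- `hw : d w.1 - x ∈ C(X ∖ K)`; drop the non-small part of `w`
  set y : CChain M X (k + 1) := w.1 with hy
  have hw' : (csingularChainComplex R M X).d (k + 1) k y - x ∈ awaySub R M X K k := hw
  have hdiff : y - smallPart M U y ∈ awaySub R M X K (k + 1) := sub_smallPart_mem_awaySub R M w.2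
  refine ⟨smallPart M U y, smallPart_mem_smallChains R M U _, ?_⟩
  have e : (csingularChainComplex R M X).d (k + 1) k (smallPart M U y) - x =
      ((csingularChainComplex R M X).d (k + 1) k y - x) -
        (csingularChainComplex R M X).d (k + 1) k (y - smallPart M U y) := by
    rw [map_sub]
    abel
  rw [e]
  exact Submodule.sub_mem _ hw' ((awaySub R M X K).d_mem hdiff)

end clocalHomology

/-! ### Cochains that are cocycles near `K`; the boundary of a cap product with a small chain -/

section Cap

variable {R M}
variable {ι : Type*} {p q n : ℕ}

/-- **A function cochain `φ ∈ Cᵖ(X; R)` is a cocycle on the `U`-small simplices** if `δφ`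
vanishes on every singular `(p+1)`-simplex contained in some `Uᵢ` — i.e. `φ` restricts to a
cocycle of each `Hom(C(Uᵢ), R)` (Miller 2020, §34: cohomology classes of a neighbourhood `U ⊇ K`
acting on `H_*(X, X - K)`; Hatcher 2002, §3.1 p. 197, cochains as functions on simplices).
[cite: Miller2020, §34, Lemma 34.3] -/
def IsCocycleOn (U : ι → Set X) (φ : SingularSimplex X p → R) : Prop :=
  ∀ τ : SingularSimplex X (p + 1), (∃ i, τ.range ⊆ U i) →
    (singularCochainComplex R R X).d p (p + 1) φ τ = 0

namespace IsCocycleOn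

/-- A cocycle on `U`-small simplices is a cocycle on `V`-small simplices for `V` refining `U`.
[folklore] -/
lemma of_refines {ι' : Type*} {U : ι → Set X} {V : ι' → Set X} (hVU : ∀ j, ∃ i, V j ⊆ U i)
    {φ : SingularSimplex X p → R} (hφ : IsCocycleOn U φ) : IsCocycleOn V φ := by
  intro τ ⟨j, hj⟩
  obtain ⟨i, hi⟩ := hVU j
  exact hφ τ ⟨i, hj.trans hi⟩

/-- Sums of cocycles near `K` are cocycles near `K`. [folklore] -/
lemma add {U : ι → Set X} {φ ψ : SingularSimplex X p → R} (hφ : IsCocycleOn U φ)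
    (hψ : IsCocycleOn U ψ) : IsCocycleOn U (φ + ψ) := by
  intro τ hτ
  rw [map_add, Pi.add_apply, hφ τ hτ, hψ τ hτ, add_zero]

/-- Scalar multiples of cocycles near `K` are cocycles near `K`. [folklore] -/
lemma smul {U : ι → Set X} {φ : SingularSimplex X p → R} (r : R) (hφ : IsCocycleOn U φ) :
    IsCocycleOn U (r • φ) := by
  intro τ hτ
  rw [map_smul, Pi.smul_apply, hφ τ hτ, smul_zero]

/-- A (global) cocycle is a cocycle on small simplices. [folklore] -/
lemma of_d_eq_zero (U : ι → Set X) {φ : SingularSimplex X p → R}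
    (hφ : (singularCochainComplex R R X).d p (p + 1) φ = 0) : IsCocycleOn U φ :=
  fun τ _ => by rw [hφ]; rfl

end IsCocycleOn

/-- The unit cochain `1 ∈ C⁰(X; R)` is a cocycle (near any `K`). [folklore] -/
lemma isCocycleOn_cochainOne (U : ι → Set X) : IsCocycleOn U (cochainOne R X) :=
  IsCocycleOn.of_d_eq_zero U (d_cochainOne (R := R) (X := X))

/-- **Capping a `U`-small chain only sees the cochain on `U`-small simplices**: if `ψ` vanishes on
the `U`-small `p`-simplices then `x ⌢ ψ = 0` for `x` `U`-small (the front face of a simplex in `Uᵢ`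
lies in `Uᵢ`; Hatcher 2002, §3.3 p. 240, locality of `⌢`). [cite: HatcherAT2002, §3.3 p. 240] -/
lemma ccapChain_eq_zero_of_forall_small (h : p + q = n) {U : ι → Set X}
    (ψ : SingularSimplex X p → R) (hψ : ∀ σ : SingularSimplex X p, (∃ i, σ.range ⊆ U i) → ψ σ = 0)
    {x : CChain M X n} (hx : x ∈ smallChains R M X U n) : ccapChain M h ψ x = 0 := by
  rw [← Finsupp.sum_single x, Finsupp.sum, map_sum]
  refine Finset.sum_eq_zero fun σ hσ => ?_
  obtain ⟨i, hi⟩ := (mem_smallChains_iff R M U x).mp hx σ hσ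
  rw [ccapChain_single, hψ _ ⟨i, (SingularSimplex.range_frontFace_subset _ σ).trans hi⟩, zero_smul,
    Finsupp.single_zero]

/-- Capping a `U`-small chain with two cochains that agree on `U`-small simplices gives the same
chain (Hatcher 2002, §3.3 p. 240, locality of `⌢`). [cite: HatcherAT2002, §3.3 p. 240] -/
lemma ccapChain_congr_of_small (h : p + q = n) {U : ι → Set X} (ψ ψ' : SingularSimplex X p → R)
    (hψ : ∀ σ : SingularSimplex X p, (∃ i, σ.range ⊆ U i) → ψ σ = ψ' σ)
    {x : CChain M X n} (hx : x ∈ smallChains R M X U n) : ccapChain M h ψ x = ccapChain M h ψ' x := by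
  rw [← Finsupp.sum_single x, Finsupp.sum, map_sum, map_sum]
  refine Finset.sum_congr rfl fun σ hσ => ?_
  obtain ⟨i, hi⟩ := (mem_smallChains_iff R M U x).mp hx σ hσ
  rw [ccapChain_single, ccapChain_single,
    hψ _ ⟨i, (SingularSimplex.range_frontFace_subset _ σ).trans hi⟩]

/-- Capping preserves `U`-smallness (the back face of a simplex in `Uᵢ` lies in `Uᵢ`). [folklore] -/
lemma ccapChain_mem_smallChains (h : p + q = n) (U : ι → Set X) (φ : SingularSimplex X p → R)
    {x : CChain M X n} (hx : x ∈ smallChains R M X U n) : ccapChain M h φ x ∈ smallChains R M X U q := by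
  rw [← Finsupp.sum_single x, Finsupp.sum, map_sum]
  refine Submodule.sum_mem _ fun σ hσ => ?_
  obtain ⟨i, hi⟩ := (mem_smallChains_iff R M U x).mp hx σ hσ
  rw [ccapChain_single]
  exact single_mem_smallChains R M U ((SingularSimplex.range_backFace_subset _ σ).trans hi) _

/-- **The boundary formula for a cocycle near `K` and a small chain**:
`∂(x ⌢ φ) = (-1)ᵖ (∂x) ⌢ φ` for `x` `U`-small and `φ` a cocycle on `U`-small simplices (Hatcher 2002,
§3.3 p. 240, `∂(σ ⌢ φ) = (-1)ᵖ(∂σ ⌢ φ - σ ⌢ δφ)`, the second term vanishing by locality).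
[cite: HatcherAT2002, §3.3 p. 240] -/
theorem d_ccapChain_of_isCocycleOn (h : p + q = n) {U : ι → Set X} {φ : SingularSimplex X p → R}
    (hφ : IsCocycleOn U φ) {x : (csingularChainComplex R M X).X (n + 1)}
    (hx : x ∈ smallChains R M X U (n + 1)) :
    (csingularChainComplex R M X).d (q + 1) q (ccapChain M (show p + (q + 1) = n + 1 by omega) φ x) =
      (-1 : R) ^ p • ccapChain M h φ ((csingularChainComplex R M X).d (n + 1) n x) := by
  rw [d_ccapChain_apply h, ccapChain_eq_zero_of_forall_small (M := M) _ _ (fun σ hσ => hφ σ hσ) hx,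
    sub_zero]

/-- Capping a `U`-small relative cycle of `(X, X ∖ K)` with a cocycle on `U`-small simplices gives a
relative cycle: `∂(x ⌢ φ) = ±(∂x) ⌢ φ ∈ C(X ∖ K)` (Hatcher 2002, §3.3 p. 240; Miller 2020, §34).
[cite: Miller2020, §34, Lemma 34.3] -/
lemma d_ccapChain_mem_awaySub (K : Set X) (h : p + q = n) {U : ι → Set X}
    {φ : SingularSimplex X p → R} (hφ : IsCocycleOn U φ) {x : (csingularChainComplex R M X).X n}
    (hxU : x ∈ smallChains R M X U n)
    (hx : (csingularChainComplex R M X).d n ((ComplexShape.down ℕ).next n) x ∈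
      awaySub R M X K ((ComplexShape.down ℕ).next n)) :
    (csingularChainComplex R M X).d q ((ComplexShape.down ℕ).next q) (ccapChain M h φ x) ∈
      awaySub R M X K ((ComplexShape.down ℕ).next q) := by
  cases q with
  | zero =>
    rw [(csingularChainComplex R M X).shape 0 _ (by simp)]
    exact Submodule.zero_mem _
  | succ q' =>
    obtain rfl : n = (p + q') + 1 := by omega
    rw [ChainComplex.next_nat_succ] at hx ⊢
    rw [d_ccapChain_of_isCocycleOn (rfl : p + q' = p + q') hφ hxU]
    exact Submodule.smul_mem _ _ (ccapChain_mem_chainsIn _ _ hx)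

end Cap

/-! ### The cap product of a cocycle near `K` with `Hₙ(X | K)` -/

namespace clocalHomology

variable {R M}
variable {ι : Type*} {p q n : ℕ}

variable (M) in
/-- The class `[x ⌢ φ] ∈ H_q(X | K)` of the cap product of a `U`-small relative cycle `x` of
`(X, X ∖ K)` with a cocycle `φ` on `U`-small simplices (Miller 2020, §34, the chain maps
`S^p(U) ⊗ Sₙ(U, U - K) → S_q(U, U - K)`). [cite: Miller2020, §34, Lemma 34.3] -/
def capSmall (K : Set X) (h : p + q = n) {U : ι → Set X} {φ : SingularSimplex X p → R}
    (hφ : IsCocycleOn U φ) (x : (csingularChainComplex R M X).X n) (hxU : x ∈ smallChains R M X U n)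
    (hx : (csingularChainComplex R M X).d n ((ComplexShape.down ℕ).next n) x ∈
      awaySub R M X K ((ComplexShape.down ℕ).next n)) : clocalHomology R M X K q :=
  (awaySub R M X K).relCls (ccapChain M h φ x) (d_ccapChain_mem_awaySub K h hφ hxU hx)

/-- **Independence of the small representative**: two `U`-small relative cycles with the same
class in `Hₙ(X | K)` have cap products with the same class in `H_q(X | K)` — they differ by a
`U`-small boundary modulo `C(X ∖ K)` (`exists_small_of_relCls_eq_zero`), and
`(∂w) ⌢ φ = ±∂(w ⌢ φ)` for `w` small (Miller 2020, §34; Hatcher 2002, §3.3 p. 240).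
[cite: Miller2020, §34, Lemma 34.3] -/
theorem capSmall_eq_of_relCls_eq {K : Set X} (hK : IsClosed K) {U : ι → Set X}
    (hUo : ∀ i, IsOpen (U i)) (hKU : K ⊆ ⋃ i, U i) (h : p + q = n) {φ : SingularSimplex X p → R}
    (hφ : IsCocycleOn U φ) {x x' : (csingularChainComplex R M X).X n}
    (hxU : x ∈ smallChains R M X U n)
    (hx : (csingularChainComplex R M X).d n ((ComplexShape.down ℕ).next n) x ∈
      awaySub R M X K ((ComplexShape.down ℕ).next n))
    (hx'U : x' ∈ smallChains R M X U n)
    (hx' : (csingularChainComplex R M X).d n ((ComplexShape.down ℕ).next n) x' ∈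
      awaySub R M X K ((ComplexShape.down ℕ).next n))
    (e : (awaySub R M X K).relCls x hx = (awaySub R M X K).relCls x' hx') :
    capSmall M K h hφ x hxU hx = capSmall M K h hφ x' hx'U hx' := by
  have hsub : (csingularChainComplex R M X).d n ((ComplexShape.down ℕ).next n) (x - x') ∈
      awaySub R M X K ((ComplexShape.down ℕ).next n) := by
    rw [map_sub]
    exact Submodule.sub_mem _ hx hx'
  have h0 : (awaySub R M X K).relCls (x - x') hsub = 0 := by
    rw [Subcomplex.relCls_sub _ x x' hx hx' hsub, e, sub_self]
  obtain ⟨w, hwU, hw⟩ :=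
    exists_small_of_relCls_eq_zero R M hK hUo hKU (Submodule.sub_mem _ hxU hx'U) hsub h0
  unfold capSmall
  refine ((awaySub R M X K).relCls_eq_relCls_iff _ _ _ _).mpr ?_
  refine (exists_d_prev_sub_mem_iff (ChainComplex.prev ℕ q) _ _).mpr
    ⟨(-1 : R) ^ p • ccapChain M (show p + (q + 1) = n + 1 by omega) φ w, ?_⟩
  rw [map_smul, d_ccapChain_of_isCocycleOn h hφ hwU, smul_smul, ← mul_pow, neg_one_mul, neg_neg,
    one_pow, one_smul, ← map_sub, ← map_sub]
  exact ccapChain_mem_chainsIn _ _ hw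

/-- **The cap product `φ ⌢ - : Hₙ(X | K) → H_q(X | K)` with a cochain `φ ∈ Cᵖ(X; R)` that is a
cocycle on the simplices small for an open cover `U` of the closed set `K`** (`p + q = n`): cap a
`U`-small representative (Miller 2020, §34: the action of `H^p(U)` on `H_*(X, X - K) = H_*(U, U - K)`
for an open neighbourhood `U` of `K`; here `U` may be a cover, as needed for Thm. 36.2).
[cite: Miller2020, §34, Lemma 34.3] -/
def capLoc {K : Set X} (hK : IsClosed K) {U : ι → Set X} (hUo : ∀ i, IsOpen (U i))
    (hKU : K ⊆ ⋃ i, U i) (h : p + q = n) {φ : SingularSimplex X p → R} (hφ : IsCocycleOn U φ)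
    (α : clocalHomology R M X K n) : clocalHomology R M X K q :=
  capSmall M K h hφ (exists_small_relCls_eq R M hK hUo hKU α).choose
    (exists_small_relCls_eq R M hK hUo hKU α).choose_spec.choose
    (exists_small_relCls_eq R M hK hUo hKU α).choose_spec.choose_spec.choose

/-- `capLoc` may be computed on any `U`-small representative. [folklore] -/
theorem capLoc_eq_capSmall {K : Set X} (hK : IsClosed K) {U : ι → Set X} (hUo : ∀ i, IsOpen (U i))
    (hKU : K ⊆ ⋃ i, U i) (h : p + q = n) {φ : SingularSimplex X p → R} (hφ : IsCocycleOn U φ)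
    {α : clocalHomology R M X K n} (x : (csingularChainComplex R M X).X n)
    (hxU : x ∈ smallChains R M X U n)
    (hx : (csingularChainComplex R M X).d n ((ComplexShape.down ℕ).next n) x ∈
      awaySub R M X K ((ComplexShape.down ℕ).next n))
    (e : (awaySub R M X K).relCls x hx = α) :
    capLoc hK hUo hKU h hφ α = capSmall M K h hφ x hxU hx :=
  capSmall_eq_of_relCls_eq hK hUo hKU h hφ _ _ _ _
    (((exists_small_relCls_eq R M hK hUo hKU α).choose_spec.choose_spec.choose_spec).trans e.symm)

section

variable {K : Set X} (hK : IsClosed K) {U : ι → Set X} (hUo : ∀ i, IsOpen (U i))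
  (hKU : K ⊆ ⋃ i, U i)
include hK hUo hKU

/-- The cap product is additive in the cochain (Hatcher 2002, §3.3, bilinearity of `⌢`).
[cite: HatcherAT2002, §3.3 p. 239] -/
theorem capLoc_add (h : p + q = n) {φ ψ : SingularSimplex X p → R} (hφ : IsCocycleOn U φ)
    (hψ : IsCocycleOn U ψ) (α : clocalHomology R M X K n) :
    capLoc hK hUo hKU h (hφ.add hψ) α = capLoc hK hUo hKU h hφ α + capLoc hK hUo hKU h hψ α := by
  obtain ⟨x, hxU, hx, rfl⟩ := exists_small_relCls_eq R M hK hUo hKU α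
  rw [capLoc_eq_capSmall hK hUo hKU h _ x hxU hx rfl, capLoc_eq_capSmall hK hUo hKU h _ x hxU hx rfl,
    capLoc_eq_capSmall hK hUo hKU h _ x hxU hx rfl]
  unfold capSmall
  have hmem : (csingularChainComplex R M X).d q ((ComplexShape.down ℕ).next q)
      (ccapChain M h φ x + ccapChain M h ψ x) ∈ awaySub R M X K ((ComplexShape.down ℕ).next q) := by
    rw [map_add]
    exact Submodule.add_mem _ (d_ccapChain_mem_awaySub K h hφ hxU hx)
      (d_ccapChain_mem_awaySub K h hψ hxU hx)
  rw [← (awaySub R M X K).relCls_add _ _ (d_ccapChain_mem_awaySub K h hφ hxU hx)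
    (d_ccapChain_mem_awaySub K h hψ hxU hx) hmem]
  exact (awaySub R M X K).relCls_congr (by rw [ccapChain_add]; rfl) _ _

/-- The cap product is homogeneous in the cochain (Hatcher 2002, §3.3, bilinearity of `⌢`).
[cite: HatcherAT2002, §3.3 p. 239] -/
theorem capLoc_smul (h : p + q = n) {φ : SingularSimplex X p → R} (r : R) (hφ : IsCocycleOn U φ)
    (α : clocalHomology R M X K n) :
    capLoc hK hUo hKU h (hφ.smul r) α = r • capLoc hK hUo hKU h hφ α := by
  obtain ⟨x, hxU, hx, rfl⟩ := exists_small_relCls_eq R M hK hUo hKU α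
  rw [capLoc_eq_capSmall hK hUo hKU h _ x hxU hx rfl, capLoc_eq_capSmall hK hUo hKU h _ x hxU hx rfl]
  unfold capSmall
  have hmem : (csingularChainComplex R M X).d q ((ComplexShape.down ℕ).next q)
      (r • ccapChain M h φ x) ∈ awaySub R M X K ((ComplexShape.down ℕ).next q) := by
    rw [map_smul]
    exact Submodule.smul_mem _ r (d_ccapChain_mem_awaySub K h hφ hxU hx)
  rw [← (awaySub R M X K).relCls_smul r _ (d_ccapChain_mem_awaySub K h hφ hxU hx) hmem]
  exact (awaySub R M X K).relCls_congr (by rw [ccapChain_smul]; rfl) _ _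

/-- **The cap product only depends on the values of the cochain on small simplices** (Miller 2020,
§34, the action factors through `H^*(U)`; Hatcher 2002, §3.3 p. 240, locality).
[cite: Miller2020, §34, Lemma 34.3] -/
theorem capLoc_congr (h : p + q = n) {φ φ' : SingularSimplex X p → R} (hφ : IsCocycleOn U φ)
    (hφ' : IsCocycleOn U φ')
    (e : ∀ σ : SingularSimplex X p, (∃ i, σ.range ⊆ U i) → φ σ = φ' σ)
    (α : clocalHomology R M X K n) :
    capLoc hK hUo hKU h hφ α = capLoc hK hUo hKU h hφ' α := by
  obtain ⟨x, hxU, hx, rfl⟩ := exists_small_relCls_eq R M hK hUo hKU α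
  rw [capLoc_eq_capSmall hK hUo hKU h _ x hxU hx rfl, capLoc_eq_capSmall hK hUo hKU h _ x hxU hx rfl]
  unfold capSmall
  exact (awaySub R M X K).relCls_congr (ccapChain_congr_of_small h φ φ' e hxU) _ _

/-- **Coboundaries cap to zero**: if `φ` agrees with `δθ` on the small simplices then
`φ ⌢ α = 0` in `H_q(X | K)` — `σ ⌢ δθ = (∂σ) ⌢ θ ± ∂(σ ⌢ θ)` and `∂σ ∈ C(X ∖ K)` (Miller 2020, §34,
the action of `H^p(U)` is well defined; Hatcher 2002, §3.3 p. 240).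
[cite: Miller2020, §34, Lemma 34.3] -/
theorem capLoc_eq_zero_of_coboundary {p' : ℕ} (h : (p' + 1) + q = n)
    {φ : SingularSimplex X (p' + 1) → R} (hφ : IsCocycleOn U φ) (θ : SingularSimplex X p' → R)
    (e : ∀ σ : SingularSimplex X (p' + 1), (∃ i, σ.range ⊆ U i) →
      φ σ = (singularCochainComplex R R X).d p' (p' + 1) θ σ)
    (α : clocalHomology R M X K n) : capLoc hK hUo hKU h hφ α = 0 := by
  obtain ⟨x, hxU, hx, rfl⟩ := exists_small_relCls_eq R M hK hUo hKU α
  rw [capLoc_eq_capSmall hK hUo hKU h _ x hxU hx rfl]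
  unfold capSmall
  obtain rfl : n = (p' + q) + 1 := by omega
  have hx' := hx
  rw [ChainComplex.next_nat_succ] at hx'
  have e1 : ccapChain M h φ x =
      ccapChain M h ((singularCochainComplex R R X).d p' (p' + 1) θ) x :=
    ccapChain_congr_of_small h _ _ e hxU
  have hbd := d_ccapChain_apply (M := M) (rfl : p' + q = p' + q) θ x
  refine ((awaySub R M X K).relCls_eq_zero_iff _ _).mpr ?_
  refine (exists_d_prev_sub_mem_iff (ChainComplex.prev ℕ q) _ _).mpr
    ⟨-((-1 : R) ^ p' • ccapChain M (show p' + (q + 1) = (p' + q) + 1 by omega) θ x), ?_⟩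
  rw [map_neg, map_smul, hbd, smul_smul, ← mul_pow, neg_one_mul, neg_neg, one_pow, one_smul, e1,
    neg_sub, sub_sub_cancel_left]
  exact Submodule.neg_mem _ (ccapChain_mem_chainsIn _ _ hx')

/-- **Naturality of the cap product under restriction to a smaller closed set** `L ⊆ K`:
`(φ ⌢ α)|_L = φ ⌢ (α|_L)` (Miller 2020, §36, the square before Thm. 36.1, "commutes by the
projection formula"; Lemma 34.3). [cite: Miller2020, Lemma 34.3] -/
theorem res_capLoc {L : Set X} (hL : IsClosed L) (hLK : L ⊆ K) (h : p + q = n)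
    {φ : SingularSimplex X p → R} (hφ : IsCocycleOn U φ) (α : clocalHomology R M X K n) :
    res R M X hLK q (capLoc hK hUo hKU h hφ α) =
      capLoc hL hUo (hLK.trans hKU) h hφ (res R M X hLK n α) := by
  obtain ⟨x, hxU, hx, rfl⟩ := exists_small_relCls_eq R M hK hUo hKU α
  have hxL : (csingularChainComplex R M X).d n ((ComplexShape.down ℕ).next n) x ∈
      awaySub R M X L ((ComplexShape.down ℕ).next n) := awaySub_mono R M hLK _ hx
  rw [capLoc_eq_capSmall hK hUo hKU h _ x hxU hx rfl, res_eq, res_eq,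
    Subcomplex.homologyMap_quotientMap_relCls,
    capLoc_eq_capSmall hL hUo (hLK.trans hKU) h _ x hxU hxL rfl]
  unfold capSmall
  rw [Subcomplex.homologyMap_quotientMap_relCls]

/-- **Independence of the cover**: computing the cap product with a refinement `V` of `U` gives the
same class (a `V`-small representative is `U`-small) (Miller 2020, Lemma 34.3).
[cite: Miller2020, Lemma 34.3] -/
theorem capLoc_refine {ι' : Type*} {V : ι' → Set X} (hVo : ∀ j, IsOpen (V j)) (hKV : K ⊆ ⋃ j, V j)
    (hVU : ∀ j, ∃ i, V j ⊆ U i) (h : p + q = n) {φ : SingularSimplex X p → R} (hφ : IsCocycleOn U φ)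
    (α : clocalHomology R M X K n) :
    capLoc hK hVo hKV h (hφ.of_refines hVU) α = capLoc hK hUo hKU h hφ α := by
  obtain ⟨x, hxV, hx, rfl⟩ := exists_small_relCls_eq R M hK hVo hKV α
  rw [capLoc_eq_capSmall hK hVo hKV h _ x hxV hx rfl,
    capLoc_eq_capSmall hK hUo hKU h _ x (smallChains_mono_of_refines R M hVU n hxV) hx rfl]
  rfl

/-- **`1 ⌢ α = α`** (Hatcher 2002, §3.3 p. 249; Miller 2020, Prop. 34.1 (1)).
[cite: Miller2020, Prop. 34.1] -/
theorem capLoc_one (h : 0 + n = n) (α : clocalHomology R M X K n) :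
    capLoc hK hUo hKU h (isCocycleOn_cochainOne (R := R) U) α = α := by
  obtain ⟨x, hxU, hx, rfl⟩ := exists_small_relCls_eq R M hK hUo hKU α
  rw [capLoc_eq_capSmall hK hUo hKU h _ x hxU hx rfl]
  unfold capSmall
  refine (awaySub R M X K).relCls_congr ?_ _ _
  conv_lhs => rw [← Finsupp.sum_single x, Finsupp.sum]
  conv_rhs => rw [← Finsupp.sum_single x, Finsupp.sum]
  rw [map_sum]
  refine Finset.sum_congr rfl fun σ _ => ?_
  rw [ccapChain_single, cochainOne_apply, one_smul, SingularSimplex.backFace_self]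

end

end clocalHomology

end Literature.AlgebraicTopology.SingularHomology
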